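import Literature.NumberTheory.Sieve.QuadraticRootsPrimeModuliDFIPoincare
import HarnessLib

/-!
# Unfolding the `L²`-norm of a Poincaré series on `Γ₀(q)∖ℍ` (DFI 1995, Prop. 4, support file)

Topic `Literature/NumberTheory/Sieve`.  Fourth support file of the elementary proof of
Proposition 4 of W. Duke, J. B. Friedlander, H. Iwaniec, *Equidistribution of roots of a
quadratic congruence to prime moduli*, Ann. of Math. 141 (1995) (after `…DFIGamma0Domain`,
`…DFIStrip`, `…DFIPoincare`).  For a kernel `φ` on `ℍ`, invariant under `z ↦ z + 1`, bounded and
supported in the heights `Y₁ ≤ Im z ≤ Y₂` (`Y₁ > 0`), and its Poincaré series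
`P = ∑_{σ ∈ Γ∞∖Γ₀(q)} φ ∘ σ` (`RootForms.poincareFn q φ`), the square of the `L²`-norm of `P` on a
fundamental domain `F` of `Γ₀(q)` is computed by unfolding twice ("the unfolding method",
Iwaniec, *Spectral methods*, §3.2; in DFI this is hidden in (17) and the Kuznetsov formula (21)):

* `∫_F |P|² dμ = ∫_{Γ∞∖ℍ} Re( P̄ φ ) dμ` (`setIntegral_norm_sq_poincareFn_eq`);
* `∫_{Γ∞∖ℍ} P̄ φ dμ = ∑_{σ} ∫_{Γ∞∖ℍ} conj(φ ∘ σ) φ dμ` (`setIntegral_conj_poincareFn_mul_eq_tsum`);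
* grouping the cosets `σ = (∗ ∗; c d)`, `c > 0`, `q ∣ c`, by `d mod c` and unfolding the sum over
  `d ≡ d₀ (mod c)` to an integral over all of `ℍ`:
  **`∫_F |P|² dμ ≤ ∫_{Γ∞∖ℍ} |φ|² dμ + ∑_{c > 0, q ∣ c} |∑_{d₀ mod c, (d₀,c)=1} ∫_ℍ conj(φ ∘ γ_{c,d₀}) φ dμ|`**
  for any matrices `γ_{c,d₀} ∈ SL₂(ℤ)` with bottom row `(c, d₀)`
  (`setIntegral_norm_sq_poincareFn_le`), together with the summability of the right-hand side.

The inner integrals are evaluated (Kloosterman sums `S(h,h;c)`, Weil's bound) in the next file.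
Everything here is proved; no statement of the paper is vendored (no new named fact, no definition).

## References

* W. Duke, J. B. Friedlander, H. Iwaniec, Ann. of Math. (2) 141 (1995), 423–441, §3 (17), (21).
  [cite: DukeFriedlanderIwaniec1995, §3]
* H. Iwaniec, *Spectral Methods of Automorphic Forms*, 2nd ed., GSM 53 (2002), §2.3 (the cosets
  `Γ∞∖Γ₀(q)`), §3.2 (the unfolding method, (3.11)–(3.12)). [cite: Iwaniec2002, §3.2]
-/

noncomputable section

namespace Literature.NumberTheory.Sieve

open scoped MatrixGroups UpperHalfPlane Real _root_.Topology _root_.ENNReal _root_.NNReal ComplexConjugate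
open _root_.UpperHalfPlane _root_.MeasureTheory _root_.Set _root_.Filter
open _root_.ModularGroup (T)
open _root_.Literature.NumberTheory.Automorphic

namespace DFI1995

variable {q : ℕ}

/-! ### The strips `m ≤ Re w < m + 1` and translation by `Γ∞` -/

/-- The strip `m ≤ Re w < m + 1` is the `T^m`-translate of the strip `0 ≤ Re w < 1`:
`(T^m)⁻¹' {m ≤ Re < m + 1} = strip`. [folklore] -/
theorem preimage_T_zpow_smul_stripAt (m : ℤ) :
    (fun w : ℍ => T ^ m • w) ⁻¹' {w : ℍ | w.re ∈ Ico (m : ℝ) (m + 1)} = strip := by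
  ext w
  simp only [mem_preimage, mem_setOf_eq, ModularGroup.re_T_zpow_smul, mem_Ico, strip]
  constructor
  · rintro ⟨h1, h2⟩; exact ⟨by linarith, by linarith⟩
  · rintro ⟨h1, h2⟩; exact ⟨by linarith, by linarith⟩

/-- The strips `m ≤ Re w < m + 1` are measurable. [folklore] -/
theorem measurableSet_stripAt (m : ℤ) : MeasurableSet {w : ℍ | w.re ∈ Ico (m : ℝ) (m + 1)} :=
  measurableSet_Ico.preimage UpperHalfPlane.continuous_re.measurable

/-- The strips `m ≤ Re w < m + 1`, `m ∈ ℤ`, cover `ℍ`. [folklore] -/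
theorem iUnion_stripAt : (⋃ m : ℤ, {w : ℍ | w.re ∈ Ico (m : ℝ) (m + 1)}) = univ := by
  ext w
  simp only [mem_iUnion, mem_setOf_eq, mem_Ico, mem_univ, iff_true]
  exact ⟨⌊w.re⌋, Int.floor_le _, Int.lt_floor_add_one _⟩

/-- The strips `m ≤ Re w < m + 1` are pairwise disjoint. [folklore] -/
theorem pairwise_disjoint_stripAt :
    Pairwise (Function.onFun Disjoint fun m : ℤ => {w : ℍ | w.re ∈ Ico (m : ℝ) (m + 1)}) := by
  intro m n hmn
  rw [Function.onFun, Set.disjoint_left]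
  rintro w ⟨h1, h2⟩ ⟨h3, h4⟩
  have h5 : (m : ℝ) < n + 1 := lt_of_le_of_lt h1 h4
  have h6 : (n : ℝ) < m + 1 := lt_of_le_of_lt h3 h2
  have h7 : m < n + 1 := by exact_mod_cast h5
  have h8 : n < m + 1 := by exact_mod_cast h6
  omega

/-- `T^m` acting on `ℍ` through `GL₂(ℝ)`. [folklore] -/
theorem mapGL_T_zpow_smul (m : ℤ) (w : ℍ) :
    (Matrix.SpecialLinearGroup.mapGL ℝ (T ^ m) : GL (Fin 2) ℝ) • w = T ^ m • w := rfl

/-- **Translation by `T^m`**: `∫_{strip} K(T^m w) dμ(w) = ∫_{m ≤ Re w < m+1} K dμ` (invariance of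
the hyperbolic measure). [cite: Iwaniec2002, §3.2] -/
theorem setIntegral_strip_comp_T_zpow_smul (K : ℍ → ℂ) (m : ℤ) :
    ∫ w in strip, K (T ^ m • w) = ∫ w in {w : ℍ | w.re ∈ Ico (m : ℝ) (m + 1)}, K w := by
  have hmp := measurePreserving_smul (Matrix.SpecialLinearGroup.mapGL ℝ (T ^ m) : GL (Fin 2) ℝ)
    (volume : Measure ℍ)
  have h := hmp.setIntegral_preimage_emb
    (measurableEmbedding_const_smul (Matrix.SpecialLinearGroup.mapGL ℝ (T ^ m) : GL (Fin 2) ℝ))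
    K {w : ℍ | w.re ∈ Ico (m : ℝ) (m + 1)}
  simp only [mapGL_T_zpow_smul] at h
  rw [preimage_T_zpow_smul_stripAt] at h
  exact h

/-- **Unfolding `Γ∞`**: for an integrable `K` on `ℍ`, `∑_{m ∈ ℤ} ∫_{strip} K(T^m w) dμ(w) = ∫_ℍ K dμ`
(the strips `m ≤ Re w < m + 1` tile `ℍ`). [cite: Iwaniec2002, §3.2 (3.12)] -/
theorem hasSum_setIntegral_strip_comp_T_zpow_smul {K : ℍ → ℂ} (hK : Integrable K) :
    HasSum (fun m : ℤ => ∫ w in strip, K (T ^ m • w)) (∫ w, K w) := by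
  simp_rw [setIntegral_strip_comp_T_zpow_smul K]
  have h := hasSum_integral_iUnion (μ := (volume : Measure ℍ)) measurableSet_stripAt
    pairwise_disjoint_stripAt (hK.integrableOn (s := ⋃ m : ℤ, {w : ℍ | w.re ∈ Ico (m : ℝ) (m + 1)}))
  rwa [iUnion_stripAt, Measure.restrict_univ] at h

/-! ### Sums over `ℤ` by residues -/

/-- **`∑_{d ∈ ℤ} f(d) = ∑_{0 ≤ r < c} ∑_{m ∈ ℤ} f(r + cm)`** for a summable `f` and `c ≥ 1`. [folklore] -/
theorem tsum_int_eq_sum_range_tsum {E : Type*} [NormedAddCommGroup E] [NormedSpace ℝ E]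
    [CompleteSpace E] {c : ℕ} (hc : 0 < c) {f : ℤ → E} (hf : Summable f) :
    ∑' d : ℤ, f d = ∑ r ∈ Finset.range c, ∑' m : ℤ, f (r + c * m) := by
  classical
  have hc' : (0 : ℤ) < c := by exact_mod_cast hc
  -- the residue classes
  have hclass : ∀ r ∈ Finset.range c, ∑' m : ℤ, f (r + c * m) =
      ∑' d : ℤ, {x : ℤ | x % c = r}.indicator f d := by
    intro r hr
    have hr' : (r : ℤ) < c := by exact_mod_cast Finset.mem_range.1 hr
    have hinj : Function.Injective fun m : ℤ => (r : ℤ) + c * m := by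
      intro m m' h
      have : (c : ℤ) * m = c * m' := by linarith
      exact mul_left_cancel₀ hc'.ne' this
    have hsupp : Function.support ({x : ℤ | x % c = r}.indicator f) ⊆
        Set.range fun m : ℤ => (r : ℤ) + c * m := by
      intro d hd
      have hd' : d % c = r := by
        by_contra h
        exact hd (Set.indicator_of_notMem (show d ∉ {x : ℤ | x % c = r} from h) f)
      refine ⟨d / c, ?_⟩
      show (r : ℤ) + c * (d / c) = d
      rw [← hd']
      exact Int.emod_add_mul_ediv d c
    rw [← hinj.tsum_eq hsupp]
    refine tsum_congr fun m => ?_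
    have hmem : (r : ℤ) + c * m ∈ {x : ℤ | x % c = r} := by
      show ((r : ℤ) + c * m) % c = r
      rw [Int.add_mul_emod_self_left, Int.emod_eq_of_lt (by exact_mod_cast Nat.zero_le r) hr']
    rw [Set.indicator_of_mem hmem]
  rw [Finset.sum_congr rfl hclass, ← Summable.tsum_finsetSum (fun r _ => hf.indicator _)]
  refine tsum_congr fun d => ?_
  have h0 : 0 ≤ d % c := Int.emod_nonneg d hc'.ne'
  have h1 : d % c < c := Int.emod_lt_of_pos d hc'
  have hmem : (d % c).toNat ∈ Finset.range c := by
    rw [Finset.mem_range]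
    omega
  rw [Finset.sum_eq_single_of_mem (d % c).toNat hmem]
  · have : d ∈ {x : ℤ | x % c = ((d % c).toNat : ℕ)} := by
      show d % c = (((d % c).toNat : ℕ) : ℤ)
      rw [Int.toNat_of_nonneg h0]
    rw [Set.indicator_of_mem this]
  · intro r _ hr
    apply Set.indicator_of_notMem
    intro h
    apply hr
    have h' : d % c = (r : ℤ) := h
    omega

/-! ### Matrices with the same bottom row -/

/-- **A `T`-invariant kernel sees only the bottom row**: if `g, g' ∈ SL₂(ℤ)` have the same bottom
row then `φ(g • w) = φ(g' • w)` (`g' g⁻¹ ∈ Γ∞ = {T^k}`). [cite: Iwaniec2002, §2.3] -/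
theorem apply_smul_eq_of_bottom_row_eq {φ : ℍ → ℂ} (hT : ∀ z : ℍ, φ (T • z) = φ z)
    {g g' : SL(2, ℤ)} (h0 : g' 1 0 = g 1 0) (h1 : g' 1 1 = g 1 1) (w : ℍ) :
    φ (g' • w) = φ (g • w) := by
  have hdet := g.det_coe
  rw [Matrix.det_fin_two] at hdet
  have hdet' := g'.det_coe
  rw [Matrix.det_fin_two] at hdet'
  -- `g' g⁻¹` has bottom row `(0, 1)`
  have hb0 : (g' * g⁻¹) 1 0 = 0 := by
    rw [Matrix.SpecialLinearGroup.coe_mul, Matrix.SpecialLinearGroup.coe_inv, Matrix.adjugate_fin_two,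
      Matrix.mul_apply, Fin.sum_univ_two]
    simp only [Matrix.of_apply, Matrix.cons_val', Matrix.cons_val_zero, Matrix.cons_val_one,
      Matrix.cons_val_fin_one, Matrix.empty_val']
    rw [h0, h1]; ring
  have hb1 : (g' * g⁻¹) 1 1 = 1 := by
    rw [Matrix.SpecialLinearGroup.coe_mul, Matrix.SpecialLinearGroup.coe_inv, Matrix.adjugate_fin_two,
      Matrix.mul_apply, Fin.sum_univ_two]
    simp only [Matrix.of_apply, Matrix.cons_val', Matrix.cons_val_zero, Matrix.cons_val_one,
      Matrix.cons_val_fin_one, Matrix.empty_val']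
    rw [h0, h1]; linear_combination hdet
  have key := eq_T_zpow_of_apply (g' * g⁻¹) hb0 hb1
  have e : g' = T ^ ((g' * g⁻¹) 0 1 : ℤ) * g := by
    conv_lhs => rw [← inv_mul_cancel_right g' g, key]
  conv_lhs => rw [e, mul_smul]
  exact RootForms.apply_T_zpow_smul hT _ _

/-! ### Sums over `Option` -/

/-- `∑_{x : Option β} g(x) = g(none) + ∑_b g(some b)` for summable `g`. [folklore] -/
theorem tsum_option_eq {β E : Type*} [NormedAddCommGroup E] [NormedSpace ℝ E] [CompleteSpace E]
    {g : Option β → E} (hg : Summable g) :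
    ∑' x : Option β, g x = g none + ∑' b : β, g (some b) := by
  classical
  rw [hg.tsum_eq_add_tsum_ite none]
  congr 1
  have hsupp : Function.support (fun x : Option β => if x = none then 0 else g x) ⊆ Set.range some := by
    intro x hx
    cases x with
    | none => simp at hx
    | some b => exact ⟨b, rfl⟩
  rw [← (Option.some_injective β).tsum_eq hsupp]
  simp

/-! ### Summability from a finite `ℝ≥0∞` bound -/

/-- A family in a normed group whose `ℝ≥0∞`-norms have finite sum is summable: Mathlib's
`Summable.of_enorm` (kept as a deprecated alias, dedup-01057). [folklore] -/
@[deprecated (since := "2026-08-16")]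
alias summable_of_tsum_enorm_ne_top := Summable.of_enorm

/-- … and its sum of norms is bounded by the `ℝ≥0∞` sum. [folklore] -/
theorem tsum_norm_le_of_tsum_enorm_le {ι : Type*} {g : ι → ℂ} {C : ℝ≥0∞} (hC : C ≠ ⊤)
    (h : ∑' i, ‖g i‖ₑ ≤ C) : ∑' i, ‖g i‖ ≤ C.toReal := by
  have hne : ∑' i, ‖g i‖ₑ ≠ ⊤ := ne_top_of_le_ne_top hC h
  have hs : Summable fun i => ‖g i‖₊ := ENNReal.tsum_coe_ne_top_iff_summable.1 hne
  have e : ∑' i, ‖g i‖ = ((∑' i, ‖g i‖₊ : ℝ≥0) : ℝ) := by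
    rw [NNReal.coe_tsum]; rfl
  rw [e, ← ENNReal.coe_toReal, ENNReal.coe_tsum hs]
  exact ENNReal.toReal_mono hC h

/-! ### The kernel: counting, support and integrability -/

/-- **At most `M` cosets contribute, each by at most `B`**: for a kernel bounded by `B` and
supported in the heights `[Y₁, Y₂]` (`Y₁ > 0`), `∑_σ ‖φ(σ w)‖ ≤ M B` in `ℝ≥0∞`, `M` the covering
multiplicity of the box `[0,1] × [Y₁,Y₂]` under `SL₂(ℤ)`. [cite: Iwaniec2002, §2.3] -/
theorem tsum_enorm_comp_toSL_smul_le {φ : ℍ → ℂ} {Y₁ Y₂ B : ℝ} (hY₁ : 0 < Y₁)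
    (hsupp : ∀ z : ℍ, φ z ≠ 0 → Y₁ ≤ z.im ∧ z.im ≤ Y₂) (hbd : ∀ z : ℍ, ‖φ z‖ ≤ B) {M : ℕ}
    (hM : ∀ w : ℍ, ∑' γ : (𝒮ℒ : Subgroup (GL (Fin 2) ℝ)),
      {w : ℍ | w.re ∈ Icc (0 : ℝ) 1 ∧ w.im ∈ Icc Y₁ Y₂}.indicator (1 : ℍ → ℝ≥0∞) (γ • w) ≤ M)
    (w : ℍ) :
    ∑' p : CuspPair q, ‖φ (p.toSL • w)‖ₑ ≤ M * ENNReal.ofReal B := by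
  classical
  obtain ⟨S, U, hU, hS⟩ := exists_finset_nhds_of_height q hY₁ w
  have hSw := hS w (mem_of_mem_nhds hU)
  set S' := S.filter fun p => Y₁ ≤ (p.toSL • w).im ∧ (p.toSL • w).im ≤ Y₂ with hS'
  have hzero : ∀ p ∉ S', ‖φ (p.toSL • w)‖ₑ = 0 := by
    intro p hp
    rw [enorm_eq_zero]
    by_contra h
    have h1 := hsupp _ h
    exact hp (Finset.mem_filter.2 ⟨hSw p h1.1, h1⟩)
  rw [tsum_eq_sum hzero]
  have hcard : ((S'.card : ℕ) : ℝ≥0∞) ≤ M := by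
    have := card_filter_heights_le (q := q) hM S w
    rwa [← hS'] at this
  calc ∑ p ∈ S', ‖φ (p.toSL • w)‖ₑ ≤ ∑ p ∈ S', ENNReal.ofReal B := by
        refine Finset.sum_le_sum fun p _ => ?_
        rw [← ofReal_norm]
        exact ENNReal.ofReal_le_ofReal (hbd _)
    _ = (S'.card : ℝ≥0∞) * ENNReal.ofReal B := by rw [Finset.sum_const, nsmul_eq_mul]
    _ ≤ M * ENNReal.ofReal B := mul_le_mul' hcard le_rfl

/-- On the strip, a kernel supported in the heights `[Y₁, Y₂]` lives on the box `[0,1] × [Y₁,Y₂]`: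
`∫_{strip} |φ| dμ ≤ B μ(box) < ∞`. [folklore] -/
theorem setLIntegral_strip_enorm_le {φ : ℍ → ℂ} {Y₁ Y₂ B : ℝ}
    (hsupp : ∀ z : ℍ, φ z ≠ 0 → Y₁ ≤ z.im ∧ z.im ≤ Y₂) (hbd : ∀ z : ℍ, ‖φ z‖ ≤ B) :
    ∫⁻ w in strip, ‖φ w‖ₑ ≤
      ENNReal.ofReal B * volume {w : ℍ | w.re ∈ Icc (0 : ℝ) 1 ∧ w.im ∈ Icc Y₁ Y₂} := by
  have hle : ∀ w ∈ strip, ‖φ w‖ₑ ≤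
      {w : ℍ | w.re ∈ Icc (0 : ℝ) 1 ∧ w.im ∈ Icc Y₁ Y₂}.indicator (fun _ => ENNReal.ofReal B) w := by
    intro w hw
    by_cases h : φ w = 0
    · rw [h, enorm_zero]; exact zero_le
    · have h1 := hsupp w h
      have hmem : w ∈ {w : ℍ | w.re ∈ Icc (0 : ℝ) 1 ∧ w.im ∈ Icc Y₁ Y₂} :=
        ⟨⟨hw.1, hw.2.le⟩, h1⟩
      rw [indicator_of_mem hmem, ← ofReal_norm]
      exact ENNReal.ofReal_le_ofReal (hbd w)
  calc ∫⁻ w in strip, ‖φ w‖ₑ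
      ≤ ∫⁻ w in strip, {w : ℍ | w.re ∈ Icc (0 : ℝ) 1 ∧ w.im ∈ Icc Y₁ Y₂}.indicator
          (fun _ => ENNReal.ofReal B) w := setLIntegral_mono' measurableSet_strip hle
    _ ≤ ∫⁻ w, {w : ℍ | w.re ∈ Icc (0 : ℝ) 1 ∧ w.im ∈ Icc Y₁ Y₂}.indicator
          (fun _ => ENNReal.ofReal B) w := setLIntegral_le_lintegral _ _
    _ = ENNReal.ofReal B * volume {w : ℍ | w.re ∈ Icc (0 : ℝ) 1 ∧ w.im ∈ Icc Y₁ Y₂} := by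
        rw [lintegral_indicator_const (measurableSet_box Y₁ Y₂)]

/-- The box has finite hyperbolic area (it is compact). [folklore] -/
theorem volume_box_lt_top {Y₁ : ℝ} (Y₂ : ℝ) (hY₁ : 0 < Y₁) :
    volume {w : ℍ | w.re ∈ Icc (0 : ℝ) 1 ∧ w.im ∈ Icc Y₁ Y₂} < ⊤ :=
  (isCompact_box (Y₂ := Y₂) hY₁).measure_lt_top

/-- `∫_{strip} |φ| dμ < ∞`. [folklore] -/
theorem setLIntegral_strip_enorm_lt_top {φ : ℍ → ℂ} {Y₁ Y₂ B : ℝ} (hY₁ : 0 < Y₁)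
    (hsupp : ∀ z : ℍ, φ z ≠ 0 → Y₁ ≤ z.im ∧ z.im ≤ Y₂) (hbd : ∀ z : ℍ, ‖φ z‖ ≤ B) :
    ∫⁻ w in strip, ‖φ w‖ₑ < ⊤ :=
  lt_of_le_of_lt (setLIntegral_strip_enorm_le hsupp hbd)
    (ENNReal.mul_lt_top ENNReal.ofReal_lt_top (volume_box_lt_top Y₂ hY₁))

/-- The kernel is integrable on the strip. [folklore] -/
theorem integrableOn_strip {φ : ℍ → ℂ} {Y₁ Y₂ B : ℝ} (hφm : Measurable φ) (hY₁ : 0 < Y₁)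
    (hsupp : ∀ z : ℍ, φ z ≠ 0 → Y₁ ≤ z.im ∧ z.im ≤ Y₂) (hbd : ∀ z : ℍ, ‖φ z‖ ≤ B) :
    Integrable φ (volume.restrict strip) :=
  ⟨hφm.aestronglyMeasurable, setLIntegral_strip_enorm_lt_top hY₁ hsupp hbd⟩

/-- The translates `w ↦ φ(σ_p • w)` are measurable. [folklore] -/
theorem measurable_comp_toSL_smul {φ : ℍ → ℂ} (hφm : Measurable φ) (p : CuspPair q) :
    Measurable fun w : ℍ => φ (p.toSL • w) := by
  have : Measurable fun w : ℍ => (Matrix.SpecialLinearGroup.mapGL ℝ p.toSL : GL (Fin 2) ℝ) • w :=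
    measurable_const_smul _
  exact hφm.comp this

/-! ### First unfolding: `∫_F |P|² = ∫_{strip} Re(P̄ φ)` -/

/-- **First unfolding.**  For a `T`-invariant kernel `φ`, bounded by `B` and supported in the
heights `[Y₁, Y₂]`, `Y₁ > 0`, with measurable bounded Poincaré series `P`, and a fundamental domain
`F` of `Γ₀(q)`:  `∫_F |P|² dμ = ∫_{strip} Re(P̄ φ) dμ`  (unfold `|P|² = P̄ ∑_σ φ∘σ` using the
`Γ₀(q)`-invariance of `P`). [cite: Iwaniec2002, §3.2 (3.11)–(3.12)] -/
theorem setIntegral_norm_sq_poincareFn_eq {φ : ℍ → ℂ} {Y₁ Y₂ B CP : ℝ} (hφm : Measurable φ)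
    (hT : ∀ z : ℍ, φ (T • z) = φ z) (hY₁ : 0 < Y₁)
    (hsupp : ∀ z : ℍ, φ z ≠ 0 → Y₁ ≤ z.im ∧ z.im ≤ Y₂) (hbd : ∀ z : ℍ, ‖φ z‖ ≤ B)
    (hPm : Measurable (RootForms.poincareFn q φ)) (hP : ∀ z : ℍ, ‖RootForms.poincareFn q φ z‖ ≤ CP)
    {F : Set ℍ} (hF : IsHypFundamentalDomain (Gamma0GL q) F) :
    ∫ w in F, ‖RootForms.poincareFn q φ w‖ ^ 2 =
      ∫ w in strip, (conj (RootForms.poincareFn q φ w) * φ w).re := by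
  set P := RootForms.poincareFn q φ with hPdef
  set Ψ : ℍ → ℝ := fun w => (conj (P w) * φ w).re with hΨ
  have hΨm : Measurable Ψ :=
    Complex.measurable_re.comp ((Complex.continuous_conj.measurable.comp hPm).mul hφm)
  have hΨT : ∀ w : ℍ, Ψ (T • w) = Ψ w := by
    intro w
    simp only [hΨ, hPdef]
    rw [poincareFn_smul_of_mem_Gamma0 q hT (RootForms.PrimVec.T_mem q), hT]
  have hfin : ∫⁻ w in strip, ‖Ψ w‖ₑ < ⊤ := by
    have hle : ∀ w, ‖Ψ w‖ₑ ≤ ENNReal.ofReal CP * ‖φ w‖ₑ := by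
      intro w
      have hCP : 0 ≤ CP := (norm_nonneg _).trans (hP w)
      simp only [hΨ]
      rw [← ofReal_norm, ← ofReal_norm, ← ENNReal.ofReal_mul hCP]
      refine ENNReal.ofReal_le_ofReal ?_
      calc ‖(conj (P w) * φ w).re‖ ≤ ‖conj (P w) * φ w‖ := Complex.abs_re_le_norm _
        _ = ‖P w‖ * ‖φ w‖ := by rw [norm_mul, Complex.norm_conj]
        _ ≤ CP * ‖φ w‖ := mul_le_mul_of_nonneg_right (hP w) (norm_nonneg _)
    calc ∫⁻ w in strip, ‖Ψ w‖ₑ ≤ ∫⁻ w in strip, ENNReal.ofReal CP * ‖φ w‖ₑ := lintegral_mono hle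
      _ = ENNReal.ofReal CP * ∫⁻ w in strip, ‖φ w‖ₑ := by
          rw [lintegral_const_mul _ hφm.enorm]
      _ < ⊤ := ENNReal.mul_lt_top ENNReal.ofReal_lt_top (setLIntegral_strip_enorm_lt_top hY₁ hsupp hbd)
  have key := setIntegral_tsum_cuspPair_eq hF hΨm hΨT hfin
  rw [← key]
  refine setIntegral_congr_fun hF.measurableSet fun w _ => ?_
  -- `∑_σ Ψ(σ w) = |P w|²`
  have hsum : Summable fun p : CuspPair q => conj (P w) * φ (p.toSL • w) := by
    obtain ⟨S, U, hU, hS⟩ := exists_finset_nhds_of_height q hY₁ w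
    refine summable_of_hasFiniteSupport ((S : Set (CuspPair q)).toFinite.subset ?_)
    intro p hp
    have h : φ (p.toSL • w) ≠ 0 := by
      intro h0
      apply hp
      show conj (P w) * φ (p.toSL • w) = 0
      rw [h0, mul_zero]
    exact hS w (mem_of_mem_nhds hU) p (hsupp _ h).1
  have e1 : ∀ p : CuspPair q, Ψ (p.toSL • w) = (conj (P w) * φ (p.toSL • w)).re := by
    intro p
    simp only [hΨ, hPdef]
    rw [poincareFn_smul_of_mem_Gamma0 q hT p.toSL_mem]
  symm
  simp_rw [e1]
  rw [← Complex.re_tsum hsum, tsum_mul_left]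
  change (conj (P w) * RootForms.poincareFn q φ w).re = ‖P w‖ ^ 2
  rw [← hPdef, Complex.conj_mul', ← Complex.ofReal_pow, Complex.ofReal_re]

/-! ### Second unfolding: expanding `P̄` -/

/-- **Expanding the Poincaré series under the integral.**  With `M` the covering multiplicity of
the box `[0,1] × [Y₁, Y₂]`:  `∫_{strip} Re(P̄ φ) dμ = Re ∑_σ ∫_{strip} conj(φ ∘ σ) φ dμ`, the family
of integrals being absolutely summable with `∑_σ ‖∫_{strip} conj(φ∘σ) φ‖ ≤ M B ∫_{strip} |φ|`
(dominated convergence: `∑_σ |φ(σ w)| ≤ M B`). [cite: Iwaniec2002, §3.2] -/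
theorem setIntegral_conj_poincareFn_mul_eq_tsum {φ : ℍ → ℂ} {Y₁ Y₂ B CP : ℝ} (hφm : Measurable φ)
    (hY₁ : 0 < Y₁)
    (hsupp : ∀ z : ℍ, φ z ≠ 0 → Y₁ ≤ z.im ∧ z.im ≤ Y₂) (hbd : ∀ z : ℍ, ‖φ z‖ ≤ B)
    (hPm : Measurable (RootForms.poincareFn q φ)) (hP : ∀ z : ℍ, ‖RootForms.poincareFn q φ z‖ ≤ CP)
    {M : ℕ} (hM : ∀ w : ℍ, ∑' γ : (𝒮ℒ : Subgroup (GL (Fin 2) ℝ)),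
      {w : ℍ | w.re ∈ Icc (0 : ℝ) 1 ∧ w.im ∈ Icc Y₁ Y₂}.indicator (1 : ℍ → ℝ≥0∞) (γ • w) ≤ M) :
    (∫ w in strip, (conj (RootForms.poincareFn q φ w) * φ w).re =
      (∑' p : CuspPair q, ∫ w in strip, conj (φ (p.toSL • w)) * φ w).re) ∧
    ∑' p : CuspPair q, ‖∫ w in strip, conj (φ (p.toSL • w)) * φ w‖ₑ ≤
      M * ENNReal.ofReal B * ∫⁻ w in strip, ‖φ w‖ₑ := by
  set P := RootForms.poincareFn q φ with hPdef
  have hφint : Integrable φ (volume.restrict strip) := integrableOn_strip hφm hY₁ hsupp hbd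
  -- the integrand `P̄ φ` is integrable on the strip
  have hfint : Integrable (fun w => conj (P w) * φ w) (volume.restrict strip) := by
    refine hφint.bdd_mul (c := CP) (Complex.continuous_conj.measurable.comp hPm).aestronglyMeasurable ?_
    exact Eventually.of_forall fun w => by rw [Complex.norm_conj]; exact hP w
  -- the family and its domination
  set G : CuspPair q → ℍ → ℂ := fun p w => conj (φ (p.toSL • w)) * φ w with hG
  have hGm : ∀ p, Measurable (G p) := fun p =>
    (Complex.continuous_conj.measurable.comp (measurable_comp_toSL_smul hφm p)).mul hφm
  have hdom : ∀ w : ℍ, ∑' p : CuspPair q, ‖G p w‖ₑ ≤ M * ENNReal.ofReal B * ‖φ w‖ₑ := by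
    intro w
    have e : ∀ p : CuspPair q, ‖G p w‖ₑ = ‖φ (p.toSL • w)‖ₑ * ‖φ w‖ₑ := by
      intro p
      simp only [hG]
      rw [enorm_mul, ← ofReal_norm (conj _), Complex.norm_conj, ofReal_norm]
    simp_rw [e]
    rw [ENNReal.tsum_mul_right]
    exact mul_le_mul' (tsum_enorm_comp_toSL_smul_le hY₁ hsupp hbd hM w) le_rfl
  have hbound : ∑' p : CuspPair q, ∫⁻ w in strip, ‖G p w‖ₑ ≤
      M * ENNReal.ofReal B * ∫⁻ w in strip, ‖φ w‖ₑ := by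
    rw [← lintegral_tsum fun p => (hGm p).enorm.aemeasurable]
    calc ∫⁻ w in strip, ∑' p : CuspPair q, ‖G p w‖ₑ
        ≤ ∫⁻ w in strip, M * ENNReal.ofReal B * ‖φ w‖ₑ := lintegral_mono fun w => hdom w
      _ = M * ENNReal.ofReal B * ∫⁻ w in strip, ‖φ w‖ₑ := by
          rw [lintegral_const_mul _ hφm.enorm]
  have hne : ∑' p : CuspPair q, ∫⁻ w in strip, ‖G p w‖ₑ ≠ ⊤ :=
    ne_top_of_le_ne_top (ENNReal.mul_ne_top (ENNReal.mul_ne_top (ENNReal.natCast_ne_top M)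
      ENNReal.ofReal_ne_top) (setLIntegral_strip_enorm_lt_top hY₁ hsupp hbd).ne) hbound
  refine ⟨?_, ?_⟩
  · -- the identity
    have h1 : ∫ w in strip, (conj (P w) * φ w).re = (∫ w in strip, conj (P w) * φ w).re := by
      have := integral_re hfint
      simpa using this
    rw [h1]
    congr 1
    have h2 : ∀ w : ℍ, conj (P w) * φ w = ∑' p : CuspPair q, G p w := by
      intro w
      simp only [hG, hPdef, RootForms.poincareFn]
      rw [Complex.conj_tsum, tsum_mul_right]
    simp_rw [h2]
    exact integral_tsum (fun p => (hGm p).aestronglyMeasurable) hne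
  · -- the bound
    calc ∑' p : CuspPair q, ‖∫ w in strip, G p w‖ₑ
        ≤ ∑' p : CuspPair q, ∫⁻ w in strip, ‖G p w‖ₑ :=
          ENNReal.tsum_le_tsum fun p => enorm_integral_le_lintegral_enorm _
      _ ≤ M * ENNReal.ofReal B * ∫⁻ w in strip, ‖φ w‖ₑ := hbound

/-! ### The off-diagonal kernels `conj(φ ∘ γ) φ` are integrable on `ℍ` -/

/-- For `γ ∈ SL₂(ℤ)` with `γ_{10} = c ≥ 1` the product `w ↦ conj(φ(γ w)) φ(w)` of two translates of a
kernel supported in the heights `[Y₁, Y₂]` (`Y₁ > 0`) is supported in the compact set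
`|c Re w + d| ≤ (Y₂/Y₁)^{1/2}`, `Y₁ ≤ Im w ≤ Y₂` (`Im γw = Im w/|cw + d|²`). [cite: Iwaniec2002, §2.3] -/
theorem support_conj_smul_mul_subset {φ : ℍ → ℂ} {Y₁ Y₂ : ℝ} (hY₁ : 0 < Y₁)
    (hsupp : ∀ z : ℍ, φ z ≠ 0 → Y₁ ≤ z.im ∧ z.im ≤ Y₂) {γ : SL(2, ℤ)} (hc : 0 < γ 1 0) (w : ℍ)
    (hw : conj (φ (γ • w)) * φ w ≠ 0) :
    |(γ 1 0 : ℝ) * w.re + γ 1 1| ≤ Real.sqrt (Y₂ / Y₁) ∧ Y₁ ≤ w.im ∧ w.im ≤ Y₂ := by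
  have h1 : φ w ≠ 0 := fun h => hw (by rw [h, mul_zero])
  have h2 : φ (γ • w) ≠ 0 := fun h => hw (by rw [h, map_zero, zero_mul])
  obtain ⟨hy1, hy2⟩ := hsupp w h1
  obtain ⟨hgy1, -⟩ := hsupp _ h2
  refine ⟨?_, hy1, hy2⟩
  rw [ModularGroup.im_smul_eq_div_normSq, ModularGroup.denom_apply] at hgy1
  have hN : 0 < Complex.normSq (((γ 1 0 : ℤ) : ℂ) * w + ((γ 1 1 : ℤ) : ℂ)) := by
    rw [Complex.normSq_pos]
    intro h0
    have := congrArg Complex.im h0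
    simp only [Complex.add_im, Complex.mul_im, Complex.intCast_re, UpperHalfPlane.coe_im,
      Complex.intCast_im, UpperHalfPlane.coe_re, zero_mul, add_zero, Complex.zero_im] at this
    have hc' : (0 : ℝ) < γ 1 0 := by exact_mod_cast hc
    exact absurd this (mul_pos hc' w.im_pos).ne'
  have hNeq : Complex.normSq (((γ 1 0 : ℤ) : ℂ) * w + ((γ 1 1 : ℤ) : ℂ)) =
      ((γ 1 0 : ℝ) * w.re + γ 1 1) ^ 2 + ((γ 1 0 : ℝ) * w.im) ^ 2 := by
    rw [Complex.normSq_apply]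
    simp only [Complex.add_re, Complex.mul_re, Complex.intCast_re, UpperHalfPlane.coe_re,
      Complex.intCast_im, UpperHalfPlane.coe_im, zero_mul, sub_zero, add_zero, Complex.add_im,
      Complex.mul_im]
    ring
  -- `normSq ≤ y/Y₁ ≤ Y₂/Y₁`
  have hle : Complex.normSq (((γ 1 0 : ℤ) : ℂ) * w + ((γ 1 1 : ℤ) : ℂ)) ≤ Y₂ / Y₁ := by
    rw [le_div_iff₀ hN] at hgy1
    rw [le_div_iff₀ hY₁]
    nlinarith
  have hsq : ((γ 1 0 : ℝ) * w.re + γ 1 1) ^ 2 ≤ Y₂ / Y₁ := by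
    rw [hNeq] at hle; nlinarith [sq_nonneg ((γ 1 0 : ℝ) * w.im)]
  exact Real.abs_le_sqrt hsq

/-- The support set `{|c Re w + d| ≤ R, Y₁ ≤ Im w ≤ Y₂}` (`c > 0`, `Y₁ > 0`) is compact. [folklore] -/
theorem isCompact_slab {c d R Y₁ Y₂ : ℝ} (hc : 0 < c) (hY₁ : 0 < Y₁) :
    IsCompact {w : ℍ | |c * w.re + d| ≤ R ∧ Y₁ ≤ w.im ∧ w.im ≤ Y₂} := by
  have hK : IsCompact ((Icc ((-d - R) / c) ((-d + R) / c)) ×ℂ (Icc Y₁ Y₂)) :=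
    isCompact_Icc.reProdIm isCompact_Icc
  have hsub : (Icc ((-d - R) / c) ((-d + R) / c)) ×ℂ (Icc Y₁ Y₂) ⊆ range ((↑) : ℍ → ℂ) := by
    rintro v ⟨-, hv⟩
    exact ⟨⟨v, lt_of_lt_of_le hY₁ hv.1⟩, rfl⟩
  have himage : {w : ℍ | |c * w.re + d| ≤ R ∧ Y₁ ≤ w.im ∧ w.im ≤ Y₂} =
      ((↑) : ℍ → ℂ) ⁻¹' ((Icc ((-d - R) / c) ((-d + R) / c)) ×ℂ (Icc Y₁ Y₂)) := by
    ext w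
    simp only [mem_setOf_eq, mem_preimage, Complex.mem_reProdIm, UpperHalfPlane.coe_re,
      UpperHalfPlane.coe_im, mem_Icc, abs_le, div_le_iff₀ hc, le_div_iff₀ hc]
    constructor
    · rintro ⟨⟨h1, h2⟩, h3, h4⟩
      exact ⟨⟨by nlinarith, by nlinarith⟩, h3, h4⟩
    · rintro ⟨⟨h1, h2⟩, h3, h4⟩
      exact ⟨⟨by nlinarith, by nlinarith⟩, h3, h4⟩
  rw [himage]
  exact UpperHalfPlane.isOpenEmbedding_coe.isInducing.isCompact_preimage' hK hsub

/-- The support set is measurable. [folklore] -/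
theorem measurableSet_slab (c d R Y₁ Y₂ : ℝ) :
    MeasurableSet {w : ℍ | |c * w.re + d| ≤ R ∧ Y₁ ≤ w.im ∧ w.im ≤ Y₂} := by
  have h1 : Measurable fun w : ℍ => |c * w.re + d| :=
    (continuous_abs.comp ((continuous_const.mul UpperHalfPlane.continuous_re).add
      continuous_const)).measurable
  exact (measurableSet_le h1 measurable_const).inter
    ((measurableSet_le measurable_const UpperHalfPlane.continuous_im.measurable).inter
      (measurableSet_le UpperHalfPlane.continuous_im.measurable measurable_const))

/-- `w ↦ φ(γ • w)` is measurable for `γ ∈ SL₂(ℤ)`. [folklore] -/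
theorem measurable_comp_sl_smul {φ : ℍ → ℂ} (hφm : Measurable φ) (γ : SL(2, ℤ)) :
    Measurable fun w : ℍ => φ (γ • w) := by
  have : Measurable fun w : ℍ => (Matrix.SpecialLinearGroup.mapGL ℝ γ : GL (Fin 2) ℝ) • w :=
    measurable_const_smul _
  exact hφm.comp this

/-- **Integrability of the off-diagonal kernels**: for `γ ∈ SL₂(ℤ)` with `γ_{10} ≥ 1`, the function
`w ↦ conj(φ(γ w)) φ(w)` is integrable on `ℍ` (bounded by `B²`, compact support). [folklore] -/
theorem integrable_conj_smul_mul {φ : ℍ → ℂ} {Y₁ Y₂ B : ℝ} (hφm : Measurable φ) (hY₁ : 0 < Y₁)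
    (hsupp : ∀ z : ℍ, φ z ≠ 0 → Y₁ ≤ z.im ∧ z.im ≤ Y₂) (hbd : ∀ z : ℍ, ‖φ z‖ ≤ B)
    {γ : SL(2, ℤ)} (hc : 0 < γ 1 0) :
    Integrable fun w : ℍ => conj (φ (γ • w)) * φ w := by
  set S : Set ℍ := {w : ℍ | |(γ 1 0 : ℝ) * w.re + γ 1 1| ≤ Real.sqrt (Y₂ / Y₁) ∧
    Y₁ ≤ w.im ∧ w.im ≤ Y₂} with hS
  have hc' : (0 : ℝ) < γ 1 0 := by exact_mod_cast hc
  have hSc : IsCompact S := isCompact_slab (d := (γ 1 1 : ℝ)) (R := Real.sqrt (Y₂ / Y₁)) hc' hY₁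
  have hmeas : Measurable fun w : ℍ => conj (φ (γ • w)) * φ w :=
    (Complex.continuous_conj.measurable.comp (measurable_comp_sl_smul hφm γ)).mul hφm
  have hsupport : Function.support (fun w : ℍ => conj (φ (γ • w)) * φ w) ⊆ S := fun w hw =>
    support_conj_smul_mul_subset hY₁ hsupp hc w hw
  rw [← integrableOn_iff_integrable_of_support_subset hsupport]
  refine Measure.integrableOn_of_bounded (μ := volume) (s := S) (M := B * B) hSc.measure_lt_top.ne
    hmeas.aestronglyMeasurable ?_
  refine Eventually.of_forall fun w => ?_
  rw [norm_mul, Complex.norm_conj]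
  have hB0 : 0 ≤ B := (norm_nonneg _).trans (hbd w)
  exact mul_le_mul (hbd _) (hbd _) (norm_nonneg _) hB0

/-! ### Regrouping the cosets by `c` and `d mod c` -/

/-- Bottom row of `γ T^m`: `(c, cm + d)`. [folklore] -/
theorem mul_T_zpow_apply_one (γ : SL(2, ℤ)) (m : ℤ) :
    (γ * T ^ m) 1 0 = γ 1 0 ∧ (γ * T ^ m) 1 1 = γ 1 0 * m + γ 1 1 := by
  constructor
  · rw [Matrix.SpecialLinearGroup.coe_mul, ModularGroup.coe_T_zpow, Matrix.mul_apply, Fin.sum_univ_two]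
    simp
  · rw [Matrix.SpecialLinearGroup.coe_mul, ModularGroup.coe_T_zpow, Matrix.mul_apply, Fin.sum_univ_two]
    simp

/-- **The cosets with a given `c`.**  Fix `c ≥ 1` with `q ∣ c` and matrices `γ_d ∈ SL₂(ℤ)` with bottom
row `(c, d)` for the `d` prime to `c`, `0 ≤ d < c`.  Then, for a `T`-invariant bounded kernel `φ`
supported in the heights `[Y₁, Y₂]`,
`∑_{d ∈ ℤ, (c,d)=1} ∫_{strip} conj(φ ∘ σ_{c,d}) φ dμ = ∑_{0 ≤ d < c, (c,d)=1} ∫_ℍ conj(φ ∘ γ_d) φ dμ`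
(group `d` by residues and unfold `∑_m ∫_{strip} K(T^m w) = ∫_ℍ K`), provided the left-hand family is
summable. [cite: Iwaniec2002, §3.2 (3.12)] -/
theorem tsum_coprime_setIntegral_eq_sum {φ : ℍ → ℂ} {Y₁ Y₂ B : ℝ} (hφm : Measurable φ)
    (hT : ∀ z : ℍ, φ (T • z) = φ z) (hY₁ : 0 < Y₁)
    (hsupp : ∀ z : ℍ, φ z ≠ 0 → Y₁ ≤ z.im ∧ z.im ≤ Y₂) (hbd : ∀ z : ℍ, ‖φ z‖ ≤ B)
    {c : ℕ} (hc : 0 < c) (hqc : (q : ℤ) ∣ c) (Γd : ℕ → SL(2, ℤ))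
    (hΓd : ∀ d : ℕ, d < c → Nat.Coprime c d → (Γd d) 1 0 = c ∧ (Γd d) 1 1 = d)
    (hsum : Summable fun d : {d : ℤ // Int.gcd (c : ℤ) d = 1} =>
      ∫ w in strip, conj (φ ((CuspPair.mk' (q := q) (c : ℤ) d.1 (by exact_mod_cast hc) hqc d.2).toSL • w)) * φ w) :
    ∑' d : {d : ℤ // Int.gcd (c : ℤ) d = 1},
        ∫ w in strip, conj (φ ((CuspPair.mk' (q := q) (c : ℤ) d.1 (by exact_mod_cast hc) hqc d.2).toSL • w)) * φ w =
      ∑ d ∈ (Finset.range c).filter (fun d => Nat.Coprime c d), ∫ w, conj (φ (Γd d • w)) * φ w := by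
  classical
  have hc' : (0 : ℤ) < c := by exact_mod_cast hc
  -- extend the family by zero to all `d ∈ ℤ`
  set g : ℤ → ℂ := fun d => if h : Int.gcd (c : ℤ) d = 1 then
    ∫ w in strip, conj (φ ((CuspPair.mk' (q := q) (c : ℤ) d hc' hqc h).toSL • w)) * φ w else 0 with hg
  have hg_sub : ∀ d : {d : ℤ // Int.gcd (c : ℤ) d = 1},
      ∫ w in strip, conj (φ ((CuspPair.mk' (q := q) (c : ℤ) d.1 hc' hqc d.2).toSL • w)) * φ w = g d.1 := by
    intro d; simp only [hg]; rw [dif_pos d.2]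
  have hg_ind : {x : ℤ | Int.gcd (c : ℤ) x = 1}.indicator g = g := by
    funext d
    by_cases h : Int.gcd (c : ℤ) d = 1
    · exact indicator_of_mem (show d ∈ {x : ℤ | Int.gcd (c : ℤ) x = 1} from h) g
    · rw [indicator_of_notMem (show d ∉ {x : ℤ | Int.gcd (c : ℤ) x = 1} from h)]
      simp only [hg]; rw [dif_neg h]
  have hgs : Summable g := by
    have h0 : Summable (g ∘ ((↑) : {x : ℤ | Int.gcd (c : ℤ) x = 1} → ℤ)) := by
      refine hsum.congr fun d => ?_
      exact (hg_sub d)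
    have := (summable_subtype_iff_indicator (f := g) (s := {x : ℤ | Int.gcd (c : ℤ) x = 1})).1 h0
    rwa [hg_ind] at this
  have h1 : ∑' d : {d : ℤ // Int.gcd (c : ℤ) d = 1},
      ∫ w in strip, conj (φ ((CuspPair.mk' (q := q) (c : ℤ) d.1 hc' hqc d.2).toSL • w)) * φ w =
      ∑' d : ℤ, g d := by
    rw [tsum_congr hg_sub]
    have := tsum_subtype {x : ℤ | Int.gcd (c : ℤ) x = 1} g
    rw [hg_ind] at this
    exact this
  rw [h1, tsum_int_eq_sum_range_tsum hc hgs, ← Finset.sum_filter_add_sum_filter_not (Finset.range c)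
    (fun d => Nat.Coprime c d)]
  -- the residues not prime to `c` contribute nothing
  have hzero : ∑ d ∈ (Finset.range c).filter (fun d => ¬ Nat.Coprime c d), ∑' m : ℤ, g (d + c * m) = 0 := by
    refine Finset.sum_eq_zero fun d hd => ?_
    rw [Finset.mem_filter] at hd
    have hne : ∀ m : ℤ, Int.gcd (c : ℤ) ((d : ℤ) + c * m) ≠ 1 := by
      intro m h
      apply hd.2
      rw [Int.gcd_add_mul_left_right, Int.gcd_natCast_natCast] at h
      exact h
    have : ∀ m : ℤ, g (d + c * m) = 0 := fun m => by simp only [hg]; rw [dif_neg (hne m)]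
    simp [this]
  rw [hzero, add_zero]
  refine Finset.sum_congr rfl fun d hd => ?_
  rw [Finset.mem_filter, Finset.mem_range] at hd
  obtain ⟨hdc, hcop⟩ := hd
  obtain ⟨hΓ0, hΓ1⟩ := hΓd d hdc hcop
  -- the kernel `K(w) = conj(φ(γ_d w)) φ(w)` and its `T^m`-translates
  set K : ℍ → ℂ := fun w => conj (φ (Γd d • w)) * φ w with hK
  have hKint : Integrable K := by
    have h0 : 0 < (Γd d) 1 0 := by rw [hΓ0]; exact hc'
    exact integrable_conj_smul_mul hφm hY₁ hsupp hbd h0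
  have hterm : ∀ m : ℤ, g (d + c * m) = ∫ w in strip, K (T ^ m • w) := by
    intro m
    have hcop' : Int.gcd (c : ℤ) ((d : ℤ) + c * m) = 1 := by
      rw [Int.gcd_add_mul_left_right, Int.gcd_natCast_natCast]
      exact hcop
    simp only [hg]
    rw [dif_pos hcop']
    refine setIntegral_congr_fun measurableSet_strip fun w _ => ?_
    simp only [hK]
    obtain ⟨hb0, hb1⟩ := mul_T_zpow_apply_one (Γd d) m
    have e1 : φ ((CuspPair.mk' (q := q) (c : ℤ) ((d : ℤ) + c * m) hc' hqc hcop').toSL • w) =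
        φ ((Γd d * T ^ m) • w) := by
      refine apply_smul_eq_of_bottom_row_eq hT ?_ ?_ w
      · rw [hb0, hΓ0]; rfl
      · rw [hb1, hΓ0, hΓ1]
        show (d : ℤ) + c * m = c * m + d
        ring
    rw [e1, mul_smul, ← RootForms.apply_T_zpow_smul hT m w]
  simp_rw [hterm]
  exact (hasSum_setIntegral_strip_comp_T_zpow_smul hKint).tsum_eq

/-! ### The bound for `∫_F |P|²` -/

/-- The identity coset: `φ(σ_{(0,1)} • w) = φ(w)` for a `T`-invariant kernel. [folklore] -/
theorem apply_one_toSL_smul {φ : ℍ → ℂ} (hT : ∀ z : ℍ, φ (T • z) = φ z) (w : ℍ) :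
    φ ((CuspPair.one q).toSL • w) = φ w := by
  have h := apply_smul_eq_of_bottom_row_eq hT (g := (1 : SL(2, ℤ))) (g' := (CuspPair.one q).toSL)
    (by rfl) (by rfl) w
  rwa [one_smul] at h

/-- **Unfolding the `L²`-norm of the Poincaré series (the bound).**  Let `φ` be a measurable
`T`-invariant kernel bounded by `B` and supported in the heights `[Y₁, Y₂]` (`Y₁ > 0`), with
measurable bounded Poincaré series `P = ∑_{σ ∈ Γ∞∖Γ₀(q)} φ ∘ σ`, `F` a fundamental domain of
`Γ₀(q)`, `M` the covering multiplicity of the box `[0,1] × [Y₁,Y₂]`, and `γ_{c,d} ∈ SL₂(ℤ)` any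
matrices with bottom rows `(c, d)` (`0 ≤ d < c`, `(c,d) = 1`).  Then
`∫_F |P|² dμ ≤ ∫_{strip} |φ|² dμ + ∑_{c ≥ 1, q ∣ c} |∑_{d mod c, (c,d)=1} ∫_ℍ conj(φ ∘ γ_{c,d}) φ dμ|`,
and the series on the right is absolutely convergent, its terms having total size at most
`M B ∫_{strip} |φ| dμ`. [cite: Iwaniec2002, §3.2 (3.11)–(3.12)] -/
theorem setIntegral_norm_sq_poincareFn_le {φ : ℍ → ℂ} {Y₁ Y₂ B CP : ℝ} (hφm : Measurable φ)
    (hT : ∀ z : ℍ, φ (T • z) = φ z) (hY₁ : 0 < Y₁)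
    (hsupp : ∀ z : ℍ, φ z ≠ 0 → Y₁ ≤ z.im ∧ z.im ≤ Y₂) (hbd : ∀ z : ℍ, ‖φ z‖ ≤ B)
    (hPm : Measurable (RootForms.poincareFn q φ)) (hP : ∀ z : ℍ, ‖RootForms.poincareFn q φ z‖ ≤ CP)
    {M : ℕ} (hM : ∀ w : ℍ, ∑' γ : (𝒮ℒ : Subgroup (GL (Fin 2) ℝ)),
      {w : ℍ | w.re ∈ Icc (0 : ℝ) 1 ∧ w.im ∈ Icc Y₁ Y₂}.indicator (1 : ℍ → ℝ≥0∞) (γ • w) ≤ M)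
    {F : Set ℍ} (hF : IsHypFundamentalDomain (Gamma0GL q) F) (Γm : ℕ → ℕ → SL(2, ℤ))
    (hΓm : ∀ c d : ℕ, 0 < c → d < c → Nat.Coprime c d → (Γm c d) 1 0 = c ∧ (Γm c d) 1 1 = d) :
    (∫ w in F, ‖RootForms.poincareFn q φ w‖ ^ 2 ≤ (∫ w in strip, ‖φ w‖ ^ 2) +
      ∑' c : ℕ, ‖if 0 < c ∧ q ∣ c then
        ∑ d ∈ (Finset.range c).filter (fun d => Nat.Coprime c d), ∫ w, conj (φ (Γm c d • w)) * φ w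
        else 0‖) ∧
    ∑' c : ℕ, ‖if 0 < c ∧ q ∣ c then
        ∑ d ∈ (Finset.range c).filter (fun d => Nat.Coprime c d), ∫ w, conj (φ (Γm c d • w)) * φ w
        else 0‖ₑ ≤ M * ENNReal.ofReal B * ∫⁻ w in strip, ‖φ w‖ₑ := by
  classical
  -- the family of strip integrals over the cosets and its summability
  set J : CuspPair q → ℂ := fun p => ∫ w in strip, conj (φ (p.toSL • w)) * φ w with hJ
  obtain ⟨heq2, hJb⟩ := setIntegral_conj_poincareFn_mul_eq_tsum hφm hY₁ hsupp hbd hPm hP hM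
  have heq1 := setIntegral_norm_sq_poincareFn_eq hφm hT hY₁ hsupp hbd hPm hP hF
  have hL : ∫⁻ w in strip, ‖φ w‖ₑ < ⊤ := setLIntegral_strip_enorm_lt_top hY₁ hsupp hbd
  have hMBL : (M : ℝ≥0∞) * ENNReal.ofReal B * ∫⁻ w in strip, ‖φ w‖ₑ ≠ ⊤ :=
    ENNReal.mul_ne_top (ENNReal.mul_ne_top (ENNReal.natCast_ne_top M) ENNReal.ofReal_ne_top) hL.ne
  have hJs : Summable J := Summable.of_enorm (ne_top_of_le_ne_top hMBL hJb)
  -- the cosets with `c > 0`, indexed by `(c, d)`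
  let ι : (Σ c : {c : ℕ // 0 < c ∧ q ∣ c}, {d : ℤ // Int.gcd (c.1 : ℤ) d = 1}) → CuspPair q :=
    fun y => CuspPair.mk' (y.1.1 : ℤ) y.2.1 (by exact_mod_cast y.1.2.1) (by exact_mod_cast y.1.2.2) y.2.2
  have hι : Function.Injective ι := by
    rintro ⟨⟨c, hc⟩, ⟨d, hd⟩⟩ ⟨⟨c', hc'⟩, ⟨d', hd'⟩⟩ h
    obtain ⟨h1, h2⟩ := CuspPair.ext_iff'.1 h
    change (c : ℤ) = c' at h1
    change d = d' at h2
    have hcc : c = c' := by exact_mod_cast h1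
    subst hcc
    subst h2
    rfl
  have hrange : ∀ p : CuspPair q, p ≠ CuspPair.one q → p ∈ Set.range ι := by
    rintro ⟨⟨c, d⟩, hp⟩ hne
    rcases hp with ⟨h1, h2⟩ | ⟨hc, hqc, hg⟩
    · change c = 0 at h1
      change d = 1 at h2
      subst h1; subst h2
      exact absurd rfl hne
    · have hcn : ((c.toNat : ℕ) : ℤ) = c := Int.toNat_of_nonneg hc.le
      refine ⟨⟨⟨c.toNat, by omega, by rw [← Int.natCast_dvd_natCast, hcn]; exact hqc⟩,
        ⟨d, by rw [hcn]; exact hg⟩⟩, ?_⟩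
      apply CuspPair.ext_iff'.2
      exact ⟨hcn, rfl⟩
  have hJι : Summable (J ∘ ι) := hJs.comp_injective hι
  -- `∑_p J p = J(one) + ∑_{(c,d)} J(σ_{c,d})`
  have hdec : ∑' p, J p = J (CuspPair.one q) + ∑' y, J (ι y) := by
    rw [hJs.tsum_eq_add_tsum_ite (CuspPair.one q)]
    congr 1
    have hsupp' : Function.support (fun p : CuspPair q => if p = CuspPair.one q then 0 else J p) ⊆
        Set.range ι := by
      intro p hp
      refine hrange p ?_
      rintro rfl
      simp at hp
    rw [← hι.tsum_eq hsupp']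
    refine tsum_congr fun y => ?_
    have hne : ι y ≠ CuspPair.one q := by
      intro h
      have := (CuspPair.ext_iff'.1 h).1
      change ((y.1.1 : ℕ) : ℤ) = 0 at this
      have h0 := y.1.2.1
      omega
    simp [hne]
  -- group by `c`
  have hsigma : ∑' y, J (ι y) = ∑' c : {c : ℕ // 0 < c ∧ q ∣ c},
      ∑' d : {d : ℤ // Int.gcd (c.1 : ℤ) d = 1}, J (ι ⟨c, d⟩) :=
    hJι.tsum_sigma' (fun c => hJι.sigma_factor c)
  -- the `c`-th term
  set X : ℕ → ℂ := fun c => if 0 < c ∧ q ∣ c then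
    ∑ d ∈ (Finset.range c).filter (fun d => Nat.Coprime c d), ∫ w, conj (φ (Γm c d • w)) * φ w else 0
    with hX
  have hXc : ∀ c : {c : ℕ // 0 < c ∧ q ∣ c},
      ∑' d : {d : ℤ // Int.gcd (c.1 : ℤ) d = 1}, J (ι ⟨c, d⟩) = X c.1 := by
    rintro ⟨c, hc, hqc⟩
    simp only [hX]
    rw [if_pos ⟨hc, hqc⟩]
    exact tsum_coprime_setIntegral_eq_sum hφm hT hY₁ hsupp hbd hc (by exact_mod_cast hqc) (Γm c)
      (fun d hd hcop => hΓm c d hc hd hcop) (hJι.sigma_factor ⟨c, hc, hqc⟩)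
  have hXsupp : Function.support X ⊆ {c : ℕ | 0 < c ∧ q ∣ c} := by
    intro c hc
    by_contra h
    exact hc (by simp only [hX]; rw [if_neg (show ¬ (0 < c ∧ q ∣ c) from h)])
  have hXtsum : ∑' c : {c : ℕ // 0 < c ∧ q ∣ c}, X c.1 = ∑' c : ℕ, X c :=
    tsum_subtype_eq_of_support_subset hXsupp
  -- the `ℝ≥0∞` bound for `X`
  have hXb : ∑' c : ℕ, ‖X c‖ₑ ≤ M * ENNReal.ofReal B * ∫⁻ w in strip, ‖φ w‖ₑ := by
    have h1 : ∑' c : ℕ, ‖X c‖ₑ = ∑' c : {c : ℕ // 0 < c ∧ q ∣ c}, ‖X c.1‖ₑ := by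
      refine (tsum_subtype_eq_of_support_subset (f := fun c => ‖X c‖ₑ) ?_).symm
      intro c hc
      refine hXsupp ?_
      intro h0
      exact hc (by simp [h0])
    rw [h1]
    calc ∑' c : {c : ℕ // 0 < c ∧ q ∣ c}, ‖X c.1‖ₑ
        ≤ ∑' c : {c : ℕ // 0 < c ∧ q ∣ c}, ∑' d : {d : ℤ // Int.gcd (c.1 : ℤ) d = 1}, ‖J (ι ⟨c, d⟩)‖ₑ := by
          refine ENNReal.tsum_le_tsum fun c => ?_
          rw [← hXc c]
          exact enorm_tsum_le_tsum_enorm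
      _ = ∑' y, ‖J (ι y)‖ₑ := (ENNReal.tsum_sigma' (fun y => ‖J (ι y)‖ₑ)).symm
      _ ≤ ∑' p, ‖J p‖ₑ := ENNReal.tsum_comp_le_tsum_of_injective hι (fun p => ‖J p‖ₑ)
      _ ≤ M * ENNReal.ofReal B * ∫⁻ w in strip, ‖φ w‖ₑ := hJb
  refine ⟨?_, hXb⟩
  -- the diagonal term
  have hdiag : (J (CuspPair.one q)).re = ∫ w in strip, ‖φ w‖ ^ 2 := by
    simp only [hJ]
    simp_rw [apply_one_toSL_smul hT, Complex.conj_mul', ← Complex.ofReal_pow]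
    rw [integral_complex_ofReal, Complex.ofReal_re]
  -- assemble
  have hXs : Summable fun c => ‖X c‖ := by
    have h := Summable.of_enorm (ne_top_of_le_ne_top hMBL hXb)
    have h' : Summable fun c => ‖X c‖₊ := ENNReal.tsum_coe_ne_top_iff_summable.1 (ne_top_of_le_ne_top hMBL hXb)
    exact NNReal.summable_coe.2 h'
  rw [heq1, heq2, hdec, hsigma, tsum_congr hXc, hXtsum, Complex.add_re, hdiag]
  refine add_le_add le_rfl ?_
  exact (Complex.re_le_norm _).trans (norm_tsum_le_tsum_norm hXs)

end DFI1995

end Literature.NumberTheory.Sieve
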